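import Summits.AtomisticToContinuum.BoseEinsteinCondensation.Theorems.BECConjugateDominationInfraredMinimumUncertaintyStubTiltedLevyIdentity
import Summits.AtomisticToContinuum.BoseEinsteinCondensation.Theorems.BECDipoleTransportTransportToWindowSmearing
import Literature.MathematicalPhysics.QuantumManyBody.PeriodicHeatFlowSpectralProofs

/-!
# Route `BECConjugateDomination`, crux `InfraredMinimumUncertainty` (stmt-AtomisticToContinuum-11784),
# line `tilted-coherence-work-variance`: the tilt reflection `t ↔ 1 − t` (toolkit)

Supports (does not close) stmt-AtomisticToContinuum-11784.  For EVERY admissible periodic state `Ψ`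
(no minimality, no inversion symmetry, no uniqueness) and `L > 0`, translation covariance of the cell
integral (`setIntegral_cellN_comp_add`) and reality of the variance profile give the reflection of the
tilt family of the line (objects of `Theorems/BECConjugateDominationTiltedCoherenceDefs.lean`):

* `tiltNorm Ψ (1−t) r = tiltNorm Ψ t (−r)`, `tiltMean Ψ (1−t) r = −tiltMean Ψ t (−r)`,
  `tiltVar Ψ (1−t) r = tiltVar Ψ t (−r)` (`δU_r(X) = −δU_{−r}(τ_r X)`, `Φ_{1−t}^{(r)}(X)² = Φ_t^{(−r)}(τ_r X)²`);
* the cell-Fourier reflection rule `ĉₙ(φ(−·)) = ĉ₋ₙ(φ)` for periodic `φ` (`cellFourierCoeff_comp_neg`,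
  negation invariance of the Haar measure of the torus) and `Re ĉₙ(U(−·)) = Re ĉₙ(U)` for real periodic `U`;
* hence `tiltVarCoeff n L Ψ (1−t) m = tiltVarCoeff n L Ψ t m` and
  **`tiltedProduct n L Ψ (1−t) m = tiltedProduct n L Ψ t m`** (`Π_{1−t}(m) = Π_t(m)`, so `Π_0 = Π_1`
  and every all-tilt statement of the line reduces to the half range `t ∈ [0, ½]`); registered form
  `tiltReflection` (sub-goal of stmt-AtomisticToContinuum-11784).

Proved by the lead's stub worker for S3 (wave 1, 2026-08-16); landed by the lead (reshape r2 folds S3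
into the half-range all-tilt stub using exactly this reflection).  Reused, not restated:
`TiltedLevy.shiftFirst_eq_add_single` (S1 file), `BECDipoleTransport.toUnitTorus_neg`.
-/

noncomputable section

open Literature.MathematicalPhysics.QuantumManyBody.BoseGas
open MeasureTheory Filter Set
open scoped ENNReal NNReal BigOperators

namespace Summit.AtomisticToContinuum.BoseEinsteinCondensation.Theorems.BECConjugateDomination

open Summit.AtomisticToContinuum.BoseEinsteinCondensation.Cruxes.InfraredMinimumUncertainty.FisherGaussianDensityMode
open Summit.AtomisticToContinuum.BoseEinsteinCondensation.Cruxes.InfraredMinimumUncertainty.TiltedCoherenceWorkVariance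
open Summit.AtomisticToContinuum.BoseEinsteinCondensation.Theorems.BECConjugateDomination.TiltedLevy
  (shiftFirst_eq_add_single)
open Summit.AtomisticToContinuum.BoseEinsteinCondensation.Theorems.BECDipoleTransport (toUnitTorus_neg)

variable {n : ℕ} {L : ℝ}

/-! ## The tilt reflection `t ↔ 1 − t` (translation covariance only; no inversion symmetry) -/

section Reflection

/-- `τ_{-r} (τ_r X) = X`. -/
theorem shiftFirst_neg_shiftFirst (r : Space) (X : Config (n + 1)) :
    shiftFirst (-r) (shiftFirst r X) = X := by
  rw [shiftFirst_eq_add_single, shiftFirst_eq_add_single, add_assoc, ← Pi.single_add,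
    add_neg_cancel, Pi.single_zero, add_zero]

/-- `τ_r` commutes with every translation of configuration space. -/
theorem shiftFirst_add (r : Space) (X C : Config (n + 1)) :
    shiftFirst r (X + C) = shiftFirst r X + C := by
  rw [shiftFirst_eq_add_single, shiftFirst_eq_add_single, add_right_comm]

/-- `τ_{r + s} X = τ_r X + s e_0`. -/
theorem shiftFirst_add_left (r s : Space) (X : Config (n + 1)) :
    shiftFirst (r + s) X = shiftFirst r X + Pi.single (0 : Fin (n + 1)) s := by
  rw [shiftFirst_eq_add_single, shiftFirst_eq_add_single, Pi.single_add, add_assoc]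

variable (Ψ : PeriodicTrialState (n + 1) L)

/-- The tilt weight is lattice periodic in the configuration. -/
theorem tiltWeight_periodic (t : ℝ) (r : Space) (X : Config (n + 1)) (i : Fin (n + 1)) (k : Fin 3) :
    tiltWeight Ψ t r (X + Pi.single i (EuclideanSpace.single k L)) = tiltWeight Ψ t r X := by
  simp only [tiltWeight, shiftFirst_add, Ψ.periodic]

/-- The work is lattice periodic in the configuration. -/
theorem work_periodic (r : Space) (X : Config (n + 1)) (i : Fin (n + 1)) (k : Fin 3) :
    work Ψ r (X + Pi.single i (EuclideanSpace.single k L)) = work Ψ r X := by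
  simp only [work, shiftFirst_add, Ψ.periodic]

/-- Reflection of the weight: `Φ_{1−t}^{(r)}(X)² = Φ_t^{(−r)}(τ_r X)²`. -/
theorem tiltWeight_one_sub (t : ℝ) (r : Space) (X : Config (n + 1)) :
    tiltWeight Ψ (1 - t) r X = tiltWeight Ψ t (-r) (shiftFirst r X) := by
  simp only [tiltWeight, shiftFirst_neg_shiftFirst]
  rw [mul_comm]
  congr 1
  ring_nf

/-- Reflection of the work: `δU_r(X) = −δU_{−r}(τ_r X)`. -/
theorem work_one_sub (r : Space) (X : Config (n + 1)) :
    work Ψ r X = -work Ψ (-r) (shiftFirst r X) := by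
  simp only [work, shiftFirst_neg_shiftFirst]
  ring

/-- Reflection of the normalisation: `φ_r(1−t) = φ_{−r}(t)` (shift invariance of the cell integral,
`setIntegral_cellN_comp_add`). -/
theorem tiltNorm_one_sub (hL : 0 < L) (t : ℝ) (r : Space) : tiltNorm Ψ (1 - t) r = tiltNorm Ψ t (-r) := by
  unfold tiltNorm
  have h : (fun X => tiltWeight Ψ (1 - t) r X) =
      fun X => tiltWeight Ψ t (-r) (X + Pi.single (0 : Fin (n + 1)) r) := by
    funext X
    rw [tiltWeight_one_sub, shiftFirst_eq_add_single]
  rw [h]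
  exact setIntegral_cellN_comp_add hL (G := fun X => tiltWeight Ψ t (-r) X)
    (fun X i k => tiltWeight_periodic Ψ t (-r) X i k) _

/-- Reflection of the mean work: `E_{μ_{1−t}^{(r)}} δU_r = −E_{μ_t^{(−r)}} δU_{−r}`. -/
theorem tiltMean_one_sub (hL : 0 < L) (t : ℝ) (r : Space) : tiltMean Ψ (1 - t) r = -tiltMean Ψ t (-r) := by
  unfold tiltMean
  rw [tiltNorm_one_sub Ψ hL]
  have h : (fun X => tiltWeight Ψ (1 - t) r X * work Ψ r X) =
      fun X => -(tiltWeight Ψ t (-r) (X + Pi.single (0 : Fin (n + 1)) r) *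
        work Ψ (-r) (X + Pi.single (0 : Fin (n + 1)) r)) := by
    funext X
    rw [tiltWeight_one_sub, work_one_sub Ψ r X, shiftFirst_eq_add_single]
    ring
  rw [h, integral_neg, setIntegral_cellN_comp_add hL (G := fun X => tiltWeight Ψ t (-r) X * work Ψ (-r) X)
    (fun X i k => by simp only [tiltWeight_periodic, work_periodic]) _]
  ring

/-- **Reflection of the work variance**: `Var_{μ_{1−t}^{(r)}}(δU_r) = Var_{μ_t^{(−r)}}(δU_{−r})`. -/
theorem tiltVar_one_sub (hL : 0 < L) (t : ℝ) (r : Space) : tiltVar Ψ (1 - t) r = tiltVar Ψ t (-r) := by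
  unfold tiltVar
  rw [tiltNorm_one_sub Ψ hL, tiltMean_one_sub Ψ hL]
  have h : (fun X => tiltWeight Ψ (1 - t) r X * (work Ψ r X - -tiltMean Ψ t (-r)) ^ 2) =
      fun X => tiltWeight Ψ t (-r) (X + Pi.single (0 : Fin (n + 1)) r) *
        (work Ψ (-r) (X + Pi.single (0 : Fin (n + 1)) r) - tiltMean Ψ t (-r)) ^ 2 := by
    funext X
    rw [tiltWeight_one_sub, work_one_sub Ψ r X, shiftFirst_eq_add_single]
    ring
  rw [h, setIntegral_cellN_comp_add hL
    (G := fun X => tiltWeight Ψ t (-r) X * (work Ψ (-r) X - tiltMean Ψ t (-r)) ^ 2)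
    (fun X i k => by simp only [tiltWeight_periodic, work_periodic]) _]

/-- The variance profile is `Lℤ³`-periodic in the displacement. -/
theorem tiltVar_add_single (t : ℝ) (r : Space) (k : Fin 3) :
    tiltVar Ψ t (r + EuclideanSpace.single k L) = tiltVar Ψ t r := by
  have hW : ∀ X, tiltWeight Ψ t (r + EuclideanSpace.single k L) X = tiltWeight Ψ t r X := fun X => by
    simp only [tiltWeight, shiftFirst_add_left, Ψ.periodic]
  have hw : ∀ X, work Ψ (r + EuclideanSpace.single k L) X = work Ψ r X := fun X => by
    simp only [work, shiftFirst_add_left, Ψ.periodic]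
  have hN : tiltNorm Ψ t (r + EuclideanSpace.single k L) = tiltNorm Ψ t r := by
    simp only [tiltNorm, hW]
  have hM : tiltMean Ψ t (r + EuclideanSpace.single k L) = tiltMean Ψ t r := by
    simp only [tiltMean, hW, hw, hN]
  simp only [tiltVar, hW, hw, hN, hM]

end Reflection

/-! ## Reflection `x ↦ −x` of cell Fourier coefficients of periodic functions -/

section FourierReflection

open Complex
open scoped ComplexConjugate

/-- As in `PeriodicBoseGasFourier.lean` / `Mathlib.Analysis.Fourier.AddCircleMulti`, the measure
on `ℝ/ℤ` is the Haar probability measure. -/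
local instance instMeasureSpaceUnitAddCircleTilt : MeasureSpace UnitAddCircle := ⟨AddCircle.haarAddCircle⟩

/-- The Haar probability measure of `ℝ/ℤ` is an additive Haar measure (local instance). -/
local instance : (volume : Measure UnitAddCircle).IsAddHaarMeasure :=
  inferInstanceAs (Measure.IsAddHaarMeasure AddCircle.haarAddCircle)

/-- The Haar probability measure of `ℝ/ℤ` is σ-finite (local instance). -/
local instance : SigmaFinite (volume : Measure UnitAddCircle) :=
  inferInstanceAs (SigmaFinite AddCircle.haarAddCircle)

/-- The Haar probability measure of `ℝ/ℤ` is negation invariant (local instance). -/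
local instance : (volume : Measure UnitAddCircle).IsNegInvariant :=
  inferInstanceAs (Measure.IsNegInvariant AddCircle.haarAddCircle)

/-- The representative of `-t` is `-`(the representative of `t`) up to a lattice vector. -/
theorem exists_fromUnitTorus_neg {L : ℝ} (hL : 0 < L) (t : UnitAddTorus (Fin 3)) :
    ∃ m : Fin 3 → ℤ, fromUnitTorus L (-t) = -fromUnitTorus L t + latticeVec L m := by
  obtain ⟨m, hm⟩ := exists_fromUnitTorus_toUnitTorus_eq hL (-fromUnitTorus L t)
  refine ⟨m, ?_⟩
  rw [← hm, toUnitTorus_neg, toUnitTorus_fromUnitTorus hL.ne']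

/-- `e_{-n}(-t) = e_n(t)` on the unit torus. -/
theorem mFourier_neg_neg (n : Fin 3 → ℤ) (t : UnitAddTorus (Fin 3)) :
    UnitAddTorus.mFourier (-n) (-t) = UnitAddTorus.mFourier n t := by
  simp only [UnitAddTorus.mFourier, ContinuousMap.coe_mk, Pi.neg_apply, fourier_apply, neg_smul_neg]

/-- **Reflection rule**: for an `Lℤ³`-periodic `φ`, `ĉₙ(φ(−·)) = ĉ₋ₙ(φ)` (negation invariance of
the Haar measure of the torus). -/
theorem cellFourierCoeff_comp_neg {L : ℝ} (hL : 0 < L) {φ : Space → ℂ}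
    (hφ : ∀ (x : Space) (k : Fin 3), φ (x + EuclideanSpace.single k L) = φ x) (n : Fin 3 → ℤ) :
    cellFourierCoeff L (fun x => φ (-x)) n = cellFourierCoeff L φ (-n) := by
  unfold cellFourierCoeff UnitAddTorus.mFourierCoeff
  have key : ∀ t : UnitAddTorus (Fin 3), torusFun L (fun x => φ (-x)) t = torusFun L φ (-t) := by
    intro t
    obtain ⟨m, hm⟩ := exists_fromUnitTorus_neg hL t
    simp only [torusFun]
    rw [hm, periodic_latticeVec hφ]
  simp_rw [key, neg_neg]
  rw [← integral_neg_eq_self (fun t => UnitAddTorus.mFourier (-n) t • torusFun L φ (-t)) volume]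
  simp_rw [mFourier_neg_neg, neg_neg]

-- adapted from `Theorems/BECInsertionCorrectorCorrectorClosureFirstCorrectorBoundFourier.cellFourierCoeff_neg_of_real`
/-- Conjugation symmetry `ĉ₋ₙ(U) = conj ĉₙ(U)` for real `U`. -/
theorem cellFourierCoeff_neg_of_real' {L : ℝ} (hL : 0 < L) (U : Space → ℝ) (n : Fin 3 → ℤ) :
    cellFourierCoeff L (fun z => (U z : ℂ)) (-n) = conj (cellFourierCoeff L (fun z => (U z : ℂ)) n) := by
  rw [cellFourierCoeff_eq_integral hL, cellFourierCoeff_eq_integral hL, Complex.real_smul,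
    Complex.real_smul, map_mul, Complex.conj_ofReal, ← integral_conj]
  congr 1
  refine integral_congr_ae (Eventually.of_forall fun x => ?_)
  simp only [map_mul, Complex.conj_ofReal, conj_cellWave, neg_neg]

/-- **Real Fourier profiles are reflection invariant**: `Re ĉₙ(U(−·)) = Re ĉₙ(U)` for real periodic `U`. -/
theorem re_cellFourierCoeff_comp_neg_of_real {L : ℝ} (hL : 0 < L) {U : Space → ℝ}
    (hU : ∀ (x : Space) (k : Fin 3), U (x + EuclideanSpace.single k L) = U x) (n : Fin 3 → ℤ) :
    (cellFourierCoeff L (fun x => ((U (-x) : ℝ) : ℂ)) n).re =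
      (cellFourierCoeff L (fun x => ((U x : ℝ) : ℂ)) n).re := by
  rw [cellFourierCoeff_comp_neg hL (φ := fun x => ((U x : ℝ) : ℂ)) (fun x k => by rw [hU]) n,
    cellFourierCoeff_neg_of_real' hL, Complex.conj_re]

end FourierReflection

section ReflectionCoeff

variable (Ψ : PeriodicTrialState (n + 1) L)

/-- **Tilt reflection of the variance profile**: `V̂_{1−t}(m) = V̂_t(m)` (translation covariance
+ reality; no inversion symmetry of `Ψ` is used). -/
theorem tiltVarCoeff_one_sub (hL : 0 < L) (t : ℝ) (m : Fin 3 → ℤ) :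
    tiltVarCoeff n L Ψ (1 - t) m = tiltVarCoeff n L Ψ t m := by
  unfold tiltVarCoeff
  simp_rw [tiltVar_one_sub Ψ hL]
  exact re_cellFourierCoeff_comp_neg_of_real hL (U := fun r => tiltVar Ψ t r)
    (fun r k => tiltVar_add_single Ψ t r k) m

/-- **`Π_{1−t}(m) = Π_t(m)`**; in particular `Π_0 = Π_1`, so tilt stability on `[0, ½]` suffices. -/
theorem tiltedProduct_one_sub (hL : 0 < L) (t : ℝ) (m : Fin 3 → ℤ) :
    tiltedProduct n L Ψ (1 - t) m = tiltedProduct n L Ψ t m := by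
  simp only [tiltedProduct, tiltVarCoeff_one_sub Ψ hL]

end ReflectionCoeff

/-! ## Registered form -/

/-- **Tilt reflection, registered form** (sub-goal `tiltReflection` of stmt-AtomisticToContinuum-11784):
`Π_{1−t}(m) = Π_t(m)` for every admissible `Ψ`, `L > 0`, every tilt `t` and mode `m`. -/
theorem tiltReflection :
    ∀ (n : ℕ) (L : ℝ), 0 < L → ∀ (Ψ : PeriodicTrialState (n + 1) L) (t : ℝ) (m : Fin 3 → ℤ),
      tiltedProduct n L Ψ (1 - t) m = tiltedProduct n L Ψ t m :=
  fun _ _ hL Ψ t m => tiltedProduct_one_sub Ψ hL t m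

end Summit.AtomisticToContinuum.BoseEinsteinCondensation.Theorems.BECConjugateDomination

end
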